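import Summits.QuantumFields.YangMills.Theses.TransportPerturbation
import Summits.QuantumFields.YangMills.Theorems.ColdStartUniversalityLatticeLangevinCocycleMain
import HarnessLib

/-!
# Route `TransportPerturbation`, LINE 10 «harris_hybrid»: the support item `WindowSemigroup`
# (stmt-QuantumFields-27874) — PROVED

Seat `ym-line-csu-p1` (g4).  For every jointly measurable family `V` of strong solutions of the step-`K` SU(2)
Shen–Zhu–Zhu dynamics from all deterministic starts, every `τ > 0`, `m ∈ ℕ` and bounded measurable `g`,
`P_{mτ/ε_K} g = (P_{τ/ε_K})^m g` for the transition operators `markovTransition V P`.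

Proof.  THE transition kernels `κ_t(x, ·) = law(V^x_t)` of the dynamics exist (`exists_transitionKernel`, law
uniqueness in the start) and satisfy Chapman–Kolmogorov `κ_{s+t} = κ_t ∘ₖ κ_s` — the Markov property, proved in
this tree from the flow (cocycle) property of the regular solution flow on the canonical space and pathwise uniqueness
(`chapmanKolmogorov_szz`).  Hence `P_{s+t} g = P_s (P_t g)` (`markovTransition_add`), and the window identity follows
by induction on `m` with `((m+1)τ/ε).toNNReal = (mτ/ε).toNNReal + (τ/ε).toNNReal`.  No sorry; standard axioms.
RECORD-rung plumbing for LINE 10; nothing here bears on the mass gap, which is NOT proved.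
-/

set_option autoImplicit false

noncomputable section

namespace Summit.QuantumFields.YangMills.Theorems.TransportPerturbation

open MeasureTheory ProbabilityTheory Filter Topology
open scoped NNReal ENNReal BigOperators
open Literature.Probability.Process Literature.MathematicalPhysics.QuantumFieldTheory
open Literature.MathematicalPhysics.QuantumLattice (fundamentalRep fundamentalLatticeRep)
open Summit.QuantumFields.YangMills.Theorems.ColdStartUniversality (exists_transitionKernel chapmanKolmogorov_szz)

/-- **Transition operators as kernel integrals**: if `κ_t(x, ·)` is the law of `V^x_t`, then
`markovTransition V P t g x = ∫ g dκ_t(x, ·)`. [folklore] -/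
theorem markovTransition_eq_integral_kernel {X Ω : Type*} [MeasurableSpace X] [MeasurableSpace Ω]
    (V : X → ℝ≥0 → Ω → X) (P : Measure Ω) (κ : ℝ≥0 → Kernel X X) (t : ℝ≥0)
    (hVm : ∀ x, Measurable (V x t)) (hκ : ∀ x, κ t x = P.map (V x t))
    {g : X → ℝ} (hg : Measurable g) :
    markovTransition V P t g = fun x => ∫ y, g y ∂(κ t x) := by
  funext x
  rw [hκ x, integral_map (hVm x).aemeasurable hg.aestronglyMeasurable]
  rfl

/-- **A kernel integral of a bounded measurable function is measurable and bounded by the same constant** (Markov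
kernels). [folklore] -/
theorem measurable_and_bounded_integral_kernel {X : Type*} [MeasurableSpace X] (κ : Kernel X X) [IsMarkovKernel κ]
    {g : X → ℝ} (hg : Measurable g) {M : ℝ} (hM : ∀ u, |g u| ≤ M) :
    Measurable (fun x => ∫ y, g y ∂(κ x)) ∧ ∀ x, |∫ y, g y ∂(κ x)| ≤ M := by
  refine ⟨(hg.stronglyMeasurable.integral_kernel (κ := κ)).measurable, fun x => ?_⟩
  have h := norm_integral_le_of_norm_le_const (μ := κ x) (f := g) (C := M)
    (Eventually.of_forall fun y => by simpa [Real.norm_eq_abs] using hM y)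
  simpa [Real.norm_eq_abs] using h

/-- **Chapman–Kolmogorov for the transition operators of a measurable solution family** of the SU(2) SZZ dynamics:
`P_{s+t} g = P_s (P_t g)` for bounded measurable `g`, and `P_t g` is again measurable and bounded by the same
constant.  From THE transition kernels (`exists_transitionKernel`) and their Chapman–Kolmogorov identity
(`chapmanKolmogorov_szz`). [cite: ShenZhuZhu2022, §3 (after Lemma 3.3, p. 13)] -/
theorem markovTransition_add {L : ℕ} [NeZero L] {β' : ℝ} {Ω : Type} [MeasurableSpace Ω]
    {P : Measure Ω} [IsProbabilityMeasure P] {W : ℝ≥0 → Ω → (Edge 3 L × NoiseIdx 2 → ℝ)}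
    (hW : IsFlatBrownian W P)
    (V : GaugeConfig 3 L (Matrix.specialUnitaryGroup (Fin 2) ℂ) → ℝ≥0 → Ω →
      GaugeConfig 3 L (Matrix.specialUnitaryGroup (Fin 2) ℂ))
    (hV : ∀ x, (∀ ω, V x 0 ω = x) ∧
      (latticeLangevinDynamics (fundamentalLatticeRep 2) β').IsSolution (fundamentalRep (Fin 2))
        hW.natFiltration P W (V x))
    (hVm : ∀ t : ℝ≥0, Measurable fun p : GaugeConfig 3 L (Matrix.specialUnitaryGroup (Fin 2) ℂ) × Ω => V p.1 t p.2)
    (s t : ℝ≥0) {g : GaugeConfig 3 L (Matrix.specialUnitaryGroup (Fin 2) ℂ) → ℝ} (hg : Measurable g)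
    {M : ℝ} (hM : ∀ u, |g u| ≤ M) :
    markovTransition V P (s + t) g = markovTransition V P s (markovTransition V P t g) ∧
      Measurable (markovTransition V P t g) ∧ ∀ u, |markovTransition V P t g u| ≤ M := by
  obtain ⟨κ, hκM, -, hreal⟩ := exists_transitionKernel L β'
  have hVx : ∀ (u : ℝ≥0) x, Measurable (V x u) := fun u x => (hVm u).comp measurable_prodMk_left
  have hlaw : ∀ (u : ℝ≥0) x, κ u x = P.map (V x u) := fun u x =>
    hreal u x Ω P W hW (V x) (hV x).1 (hV x).2
  have hrep : ∀ (u : ℝ≥0) {f : GaugeConfig 3 L (Matrix.specialUnitaryGroup (Fin 2) ℂ) → ℝ}, Measurable f →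
      markovTransition V P u f = fun x => ∫ y, f y ∂(κ u x) := fun u f hf =>
    markovTransition_eq_integral_kernel V P κ u (hVx u) (hlaw u) hf
  obtain ⟨hQm, hQb⟩ := measurable_and_bounded_integral_kernel (κ t) hg hM
  have hQm' : Measurable (markovTransition V P t g) := by rw [hrep t hg]; exact hQm
  refine ⟨?_, hQm', fun u => by rw [hrep t hg]; exact hQb u⟩
  rw [hrep (s + t) hg, hrep s hQm', chapmanKolmogorov_szz β' κ hreal s t]
  funext x
  rw [Kernel.comp_apply]
  have hint : Integrable g ((κ s x).bind (κ t)) := by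
    haveI : IsProbabilityMeasure ((κ s x).bind (κ t)) := by
      constructor
      rw [Measure.bind_apply MeasurableSet.univ (κ t).measurable.aemeasurable]
      simp
    exact (integrable_const M).mono' hg.aestronglyMeasurable
      (Eventually.of_forall fun z => by simpa [Real.norm_eq_abs] using hM z)
  rw [Literature.Probability.Process.Harris.integral_comp_measure (κ t) (κ s x) hint, hrep t hg]

/-- **`WindowSemigroup` (item stmt-QuantumFields-27874) holds**: `P_{mτ/ε_K} g = (P_{τ/ε_K})^m g` for every jointly
measurable strong-solution family of the step-`K` SU(2) SZZ dynamics, every `τ > 0`, `m` and bounded measurable `g`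
— Chapman–Kolmogorov (`markovTransition_add`) and induction on `m`. [cite: ShenZhuZhu2022, §3 (after Lemma 3.3, p. 13)] -/
theorem windowSemigroup_proof : Summit.QuantumFields.YangMills.Theses.TransportPerturbation.WindowSemigroup := by
  unfold Summit.QuantumFields.YangMills.Theses.TransportPerturbation.WindowSemigroup
  intro F γ _hγ K Ω mΩ P hP W hW V hV τ hτ m g hg hgb
  have hε : 0 < (F.P K).eps := (F.P K).eps_pos
  have hV' : ∀ x, (∀ ω, V x 0 ω = x) ∧
      (latticeLangevinDynamics (fundamentalLatticeRep 2) ((γ * (F.P K).eps)⁻¹ / 2)).IsSolution (fundamentalRep (Fin 2))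
        hW.natFiltration P W (V x) := fun x => hV.1 x
  have hVm := hV.2
  -- induction on `m`, for all bounded measurable `g`
  induction m generalizing g with
  | zero =>
    have h0 : (((0 : ℕ) : ℝ) * τ / (F.P K).eps).toNNReal = 0 := by simp
    rw [h0, Function.iterate_zero, id]
    funext x
    simp [markovTransition, (hV'  x).1]
  | succ n ih =>
    obtain ⟨M, hM⟩ := hgb
    have hsucc : (((n + 1 : ℕ) : ℝ) * τ / (F.P K).eps).toNNReal =
        (((n : ℕ) : ℝ) * τ / (F.P K).eps).toNNReal + (τ / (F.P K).eps).toNNReal := by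
      rw [← Real.toNNReal_add (by positivity) (by positivity)]
      congr 1
      push_cast
      ring
    obtain ⟨hadd, hQm, hQb⟩ := markovTransition_add hW V hV' hVm ((((n : ℕ) : ℝ) * τ / (F.P K).eps).toNNReal)
      ((τ / (F.P K).eps).toNNReal) hg hM
    rw [hsucc, hadd, Function.iterate_succ_apply]
    exact ih _ hQm ⟨M, hQb⟩

end Summit.QuantumFields.YangMills.Theorems.TransportPerturbation

end
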